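import Summits.QuantumFields.YangMills.Theorems.BalabanUVNodesN15KingModelTorusFreeEnergyExponentialRate
import HarnessLib

/-!
# BalabanUVNodes ∕ N15 — THE KING-MODEL RUNG (PART Ϟ-p): THE LATTICE FOURIER COEFFICIENTS OF THE FREE LOG-SYMBOL `ln(m²+cΣ_μ(2−2cos p_μ))` ARE NON-POSITIVE OFF THE ORIGIN
# (Neumann series in the hopping symbol `Σ_μcos p_μ`, whose powers have non-negative coefficients = walk counts; term-by-term integration over the zone)
# (Track A, DAG node N15 = NE2; FAN-OUT v1.1 §N15 s3 «KING-MODEL RUNG»; King (4.4) p.670; count-neutral)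

HONEST FRAMING.  Count-neutral (cell `pub-ymgap`, seat `pub-ymgap-dag-n15-e` g41; `--supports stmt-QuantumFields-27366 --as helper` = K3⁸).  TEMPLATE LITERATURE: C. King, Commun. Math.
Phys. **102** (1986) 649–677 [King1986]: (2.13) p.653, (3.89) p.668, (4.4) p.670, §4 p.670 l.8–13; T. Bałaban, Commun. Math. Phys. **89** (1983) 571–597 [Balaban1983RegularityDecay]:
(2.43) p.584 (lattice Fourier kernels `(2π)^{−d}∫G(p)e^{ip·x}dp`).  Part Ϟ-n introduced the log-symbol `logSymC` and its lattice Fourier coefficients `logKerC = ĥ` and proved the two-sided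
exponential rate by Poisson summation; the SIGN of the periodic finite-size correction is the sign of `ĥ` off the origin, supplied HERE (consumed by part Ϟ-q's sandwich):
§1 the hopping symbol `X(P) = Σ_μcos P_μ` (`hopSymC`) and the coefficients `W_k(z)` of its powers (`hopPowKer`): ★ `hopPowKer_succ` (the walk recursion `W_{k+1}(z) = ½Σ_μ(W_k(z+e_μ) +
W_k(z−e_μ))` — a phase in the multiplier translates the kernel, pv17 `latticeKernel_phase_mul`), `hopPowKer_zero` (`W_0 = δ`, `latticeKernel_one`), ★★ **`hopPowKer_im_eq_zero_and_re_nonneg`**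
(`W_k(z)` is a non-negative real), ★ `norm_latticeKernel_le_of_bound` (`‖K̂(z)‖ ≤ sup_zone‖K‖`, since `(2π)^{−(d+1)}·vol = 1`), `norm_hopPowKer_le` (`≤ (d+1)^k`); §2 the Neumann series
`ln(m²+cΣ(2−2cos p)) = ln A − Σ_{n≥1}(tX)ⁿ∕n` with `A = m²+2c(d+1)`, `t = 2c∕A` (`hopRatio`; `t(d+1) < 1` because `m² > 0`): ★ `hasSum_log_sub_kingLogSym` (Mathlib's
`Real.hasSum_pow_div_log_of_abs_lt_one`), `log_sub_logSymC_ofRealVec_eq_tsum`, `latticeKernel_hopTerm`, `norm_hopTerm_le`; §3 ★★★ **`logKerC_eq_sub_tsum`** (`ĥ(z) = ln A·δ_{z,0} −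
Σ_{n≥0}tⁿ⁺¹∕(n+1)·W_{n+1}(z)`: term-by-term integration of the uniformly convergent series, `integral_tsum_of_summable_integral_norm` with the geometric majorant `(t(d+1))ⁿ⁺¹`),
`summable_hopTerm_mul_hopPowKer`, ★★★ **`logKerC_re_nonpos`** (`Re ĥ(z) ≤ 0` for every `z ≠ 0`, `c ≥ 0`, `m² > 0`).

PRIOR TREE ART (named, USED not restated): Ε-a (`latticeKernel_add'`, `phaseC_e`, `phaseC_neg_e`), Ϟ-n (`logSymC`, `logKerC`, `stripRegular_logSymC`, `logSymC_ofRealVec`), Ε-m (`kingLogSym`),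
pv17 `B4ContourShift` (`latticeKernel`, `fourierBox`, `integrand`, `BZ`, `norm_cexp_phase`, `StripRegular.integrableOn`), `B4Green244` (`e`, `phaseC`, `latticeKernel_phase_mul`, `latticeKernel_one`,
`latticeKernel_sum_mul`, `integrableOn_of_differentiableAt`), `B4Green242Bridge` (`latticeKernel_sub`, `latticeKernel_const_mul`).  NOT Bałaban's covariant objects; NOT a node discharge
(N15 is booked through n15-a's knit, untouched); nothing continuum-YM ∕ `ℝ⁴` ∕ OS ∕ Clay.  0 `sorry`; 3 small `def`s (`hopSymC`, `hopPowKer`, `hopRatio`).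

HONEST SCOPE.  King's `A = 0` free symbol, `c ≥ 0`, `m² > 0`; the statement concerns the LOG-symbol's coefficients OFF the origin (`ĥ(0) = f_∞` has no sign); strictness is not claimed.
Locators: [King1986] (2.13) p.653, (4.4) p.670; [Balaban1983RegularityDecay] (2.43) p.584.
-/

noncomputable section

open scoped BigOperators
open Finset Complex MeasureTheory

namespace Summit.QuantumFields.YangMills.BalabanUVNodes.N15KingModelRung.TorusSpectral

open Literature.MathematicalPhysics.QuantumFieldTheory.Balaban1983to89.B4Strip (ofRealVec)
open Literature.MathematicalPhysics.QuantumFieldTheory.Balaban1983to89.B4ContourShift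
open Literature.MathematicalPhysics.QuantumFieldTheory.Balaban1983to89.B4Green244 (e phaseC phaseC_ofRealVec latticeKernel_phase_mul latticeKernel_one latticeKernel_congr
  latticeKernel_sum_mul integrableOn_of_differentiableAt)
open Literature.MathematicalPhysics.QuantumFieldTheory.Balaban1983to89.B4Green242Bridge (latticeKernel_sub latticeKernel_const_mul)

variable {d : ℕ}

/-! ## §1 The powers of the hopping symbol have non-negative lattice Fourier coefficients -/

section Hop

/-- THE NEAREST-NEIGHBOUR HOPPING SYMBOL `X(P) = Σ_μ cos P_μ` (complex momenta). [cite: King1986, (2.13) p.653, (4.4) p.670] -/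
def hopSymC (P : Fin (d + 1) → ℂ) : ℂ := ∑ μ, Complex.cos (P μ)

/-- THE LATTICE FOURIER COEFFICIENTS `W_k(z) = (2π)^{−(d+1)}∫_{[−π,π]^{d+1}}(Σ_μcos p_μ)^k e^{ip·z}dp` of the powers of the hopping symbol (`= 2^{−k}·#{k-step nearest-neighbour walks
0 → z}`, not used in that form). [cite: Balaban1983RegularityDecay, (2.43) p.584] -/
def hopPowKer (k : ℕ) (z : Fin (d + 1) → ℤ) : ℂ := latticeKernel (fun P => hopSymC P ^ k) z

/-- the hopping symbol is entire. [folklore] -/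
theorem differentiable_hopSymC : Differentiable ℂ (fun P : Fin (d + 1) → ℂ => hopSymC P) := by
  unfold hopSymC
  exact Differentiable.fun_sum fun μ _ => by fun_prop

/-- `X(P) = Σ_μ ½(e^{iP·e_μ} + e^{−iP·e_μ})`. [folklore] -/
theorem hopSymC_eq_sum_exp (P : Fin (d + 1) → ℂ) :
    hopSymC P = ∑ μ, (1 / 2 : ℂ) * (cexp (I * phaseC P (e μ)) + cexp (I * phaseC P (-e μ))) := by
  unfold hopSymC
  refine Finset.sum_congr rfl fun μ _ => ?_
  rw [phaseC_e, phaseC_neg_e, Complex.cos, show P μ * I = I * P μ from mul_comm _ _, show -P μ * I = I * -P μ by ring]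
  ring

/-- on the real zone `X(p) = Σ_μcos p_μ ∈ ℝ`. [folklore] -/
theorem hopSymC_ofRealVec (p : Fin (d + 1) → ℝ) : hopSymC (ofRealVec p) = ((∑ μ, Real.cos (p μ) : ℝ) : ℂ) := by
  unfold hopSymC ofRealVec
  push_cast
  rfl

/-- `‖X(p)‖ ≤ d+1` on the real zone. [folklore] -/
theorem norm_hopSymC_ofRealVec_le (p : Fin (d + 1) → ℝ) : ‖hopSymC (ofRealVec p)‖ ≤ (d + 1 : ℝ) := by
  rw [hopSymC_ofRealVec, Complex.norm_real, Real.norm_eq_abs]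
  calc |∑ μ, Real.cos (p μ)| ≤ ∑ μ, |Real.cos (p μ)| := Finset.abs_sum_le_sum_abs _ _
    _ ≤ ∑ _μ : Fin (d + 1), (1 : ℝ) := Finset.sum_le_sum fun μ _ => Real.abs_cos_le_one _
    _ = d + 1 := by simp

/-- the phase-multiplied powers `e^{iP·s}X(P)^k` are entire. [folklore] -/
theorem differentiable_phase_mul_hopPow (s : Fin (d + 1) → ℤ) (k : ℕ) :
    Differentiable ℂ (fun P : Fin (d + 1) → ℂ => cexp (I * phaseC P s) * hopSymC P ^ k) := by
  have h1 : Differentiable ℂ (fun P : Fin (d + 1) → ℂ => cexp (I * phaseC P s)) := by unfold phaseC; fun_prop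
  exact h1.mul (differentiable_hopSymC.pow k)

/-- ★ **THE WALK RECURSION** `W_{k+1}(z) = Σ_μ ½(W_k(z+e_μ) + W_k(z−e_μ))` (a phase `e^{±iP_μ}` in the multiplier translates the kernel by `±e_μ`).
[cite: Balaban1983RegularityDecay, (2.43) p.584] -/
theorem hopPowKer_succ (k : ℕ) (z : Fin (d + 1) → ℤ) :
    hopPowKer (k + 1) z = ∑ μ, (1 / 2 : ℂ) * (hopPowKer k (z + e μ) + hopPowKer k (z - e μ)) := by
  unfold hopPowKer
  have hfun : (fun P : Fin (d + 1) → ℂ => hopSymC P ^ (k + 1))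
      = fun P => ∑ μ, (1 / 2 : ℂ) * (cexp (I * phaseC P (e μ)) * hopSymC P ^ k + cexp (I * phaseC P (-e μ)) * hopSymC P ^ k) := by
    funext P
    rw [pow_succ', hopSymC_eq_sum_exp, Finset.sum_mul]
    exact Finset.sum_congr rfl fun μ _ => by ring
  rw [hfun, latticeKernel_sum_mul Finset.univ (fun _ => (1 / 2 : ℂ))
    (fun μ P => cexp (I * phaseC P (e μ)) * hopSymC P ^ k + cexp (I * phaseC P (-e μ)) * hopSymC P ^ k) z
    (fun μ _ => integrableOn_of_differentiableAt
      (fun p _ => ((differentiable_phase_mul_hopPow (e μ) k).add (differentiable_phase_mul_hopPow (-e μ) k)).differentiableAt) z)]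
  refine Finset.sum_congr rfl fun μ _ => ?_
  rw [latticeKernel_add' z (integrableOn_of_differentiableAt (fun p _ => (differentiable_phase_mul_hopPow (e μ) k).differentiableAt) z)
      (integrableOn_of_differentiableAt (fun p _ => (differentiable_phase_mul_hopPow (-e μ) k).differentiableAt) z),
    latticeKernel_phase_mul, latticeKernel_phase_mul, ← sub_eq_add_neg]

/-- `W_0 = δ` (the kernel of the multiplier `1`). [cite: Balaban1983RegularityDecay, (2.43) p.584] -/
theorem hopPowKer_zero (z : Fin (d + 1) → ℤ) : hopPowKer 0 z = if z = 0 then 1 else 0 := by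
  unfold hopPowKer
  simp only [pow_zero]
  exact latticeKernel_one z

/-- ★★ **`W_k(z)` IS A NON-NEGATIVE REAL** for every `k` and `z` (induction on the walk recursion). [cite: Balaban1983RegularityDecay, (2.43) p.584] -/
theorem hopPowKer_im_eq_zero_and_re_nonneg (k : ℕ) : ∀ z : Fin (d + 1) → ℤ, (hopPowKer k z).im = 0 ∧ 0 ≤ (hopPowKer k z).re := by
  induction k with
  | zero =>
    intro z
    rw [hopPowKer_zero]
    split_ifs <;> simp
  | succ k ih =>
    intro z
    rw [hopPowKer_succ, Complex.im_sum, Complex.re_sum]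
    have hhalf : (1 / 2 : ℂ) = ((1 / 2 : ℝ) : ℂ) := by push_cast; ring
    refine ⟨Finset.sum_eq_zero fun μ _ => ?_, Finset.sum_nonneg fun μ _ => ?_⟩
    · rw [hhalf, Complex.im_ofReal_mul, Complex.add_im, (ih _).1, (ih _).1, add_zero, mul_zero]
    · rw [hhalf, Complex.re_ofReal_mul, Complex.add_re]
      exact mul_nonneg (by norm_num) (add_nonneg (ih _).2 (ih _).2)

/-- `Re W_k(z) ≥ 0`. [cite: Balaban1983RegularityDecay, (2.43) p.584] -/
theorem hopPowKer_re_nonneg (k : ℕ) (z : Fin (d + 1) → ℤ) : 0 ≤ (hopPowKer k z).re := (hopPowKer_im_eq_zero_and_re_nonneg k z).2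

/-- `W_k(z)` is real. [cite: Balaban1983RegularityDecay, (2.43) p.584] -/
theorem hopPowKer_eq_re (k : ℕ) (z : Fin (d + 1) → ℤ) : hopPowKer k z = (((hopPowKer k z).re : ℝ) : ℂ) :=
  Complex.ext (by simp) (by simp [(hopPowKer_im_eq_zero_and_re_nonneg k z).1])

/-- ★ **SUP BOUND FOR LATTICE KERNELS**: `‖K̂(z)‖ ≤ M` whenever `‖K‖ ≤ M` on the real zone (`(2π)^{−(d+1)}·vol = 1`). [cite: Balaban1983RegularityDecay, (2.43) p.584] -/
theorem norm_latticeKernel_le_of_bound {G : (Fin (d + 1) → ℂ) → ℂ} {M : ℝ} (hG : ∀ p ∈ BZ (d + 1), ‖G (ofRealVec p)‖ ≤ M) (z : Fin (d + 1) → ℤ) :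
    ‖latticeKernel G z‖ ≤ M := by
  have hvol : (volume : Measure (Fin (d + 1) → ℝ)).real (BZ (d + 1)) = (2 * Real.pi) ^ (d + 1) := by
    rw [measureReal_def, BZ, Real.volume_Icc_pi_toReal (fun _ => by simp only; linarith [Real.pi_pos])]
    simp only [sub_neg_eq_add, Finset.prod_const, Finset.card_univ, Fintype.card_fin]
    ring
  have hlt : volume (BZ (d + 1)) < ⊤ := by unfold BZ; exact measure_Icc_lt_top
  have hint : ‖fourierBox G z‖ ≤ M * (2 * Real.pi) ^ (d + 1) := by
    unfold fourierBox
    rw [← hvol]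
    refine norm_setIntegral_le_of_norm_le_const hlt fun p hp => ?_
    unfold integrand
    rw [norm_mul, norm_cexp_phase, mul_one]
    exact hG p hp
  have hpos : (0 : ℝ) < (2 * Real.pi) ^ (d + 1) := by positivity
  unfold latticeKernel
  rw [norm_smul, Real.norm_eq_abs, abs_of_pos (inv_pos.mpr hpos)]
  calc ((2 * Real.pi) ^ (d + 1))⁻¹ * ‖fourierBox G z‖ ≤ ((2 * Real.pi) ^ (d + 1))⁻¹ * (M * (2 * Real.pi) ^ (d + 1)) := by gcongr
    _ = M := by field_simp

/-- `‖W_k(z)‖ ≤ (d+1)^k`. [cite: Balaban1983RegularityDecay, (2.43) p.584] -/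
theorem norm_hopPowKer_le (k : ℕ) (z : Fin (d + 1) → ℤ) : ‖hopPowKer k z‖ ≤ (d + 1 : ℝ) ^ k :=
  norm_latticeKernel_le_of_bound (fun p _ => by rw [norm_pow]; exact pow_le_pow_left₀ (norm_nonneg _) (norm_hopSymC_ofRealVec_le p) k) z

end Hop

/-! ## §2 The Neumann series of the log-symbol in the hopping symbol -/

section Neumann

/-- THE HOPPING RATIO `t = 2c∕(m² + 2c(d+1))` (so that `m² + cΣ_μ(2−2cos p_μ) = (m²+2c(d+1))·(1 − tΣ_μcos p_μ)`). [cite: King1986, (4.4) p.670] -/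
def hopRatio (c m2 : ℝ) (d : ℕ) : ℝ := 2 * c / (m2 + 2 * c * (d + 1))

variable {c m2 : ℝ}

/-- `t ≥ 0`. [folklore] -/
theorem hopRatio_nonneg (hc : 0 ≤ c) (hm : 0 < m2) (d : ℕ) : 0 ≤ hopRatio c m2 d := by
  unfold hopRatio; positivity

/-- `t·(d+1) < 1` (the mass makes the Neumann series converge uniformly on the zone). [folklore] -/
theorem hopRatio_mul_lt_one (hc : 0 ≤ c) (hm : 0 < m2) (d : ℕ) : hopRatio c m2 d * (d + 1) < 1 := by
  unfold hopRatio
  have hA : 0 < m2 + 2 * c * (d + 1) := by positivity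
  rw [div_mul_eq_mul_div, div_lt_one hA]
  linarith

/-- ★ **THE NEUMANN SERIES OF THE LOG-SYMBOL**: `ln(m²+2c(d+1)) − ln(m²+cΣ_μ(2−2cos p_μ)) = Σ_{n≥0}(tΣ_μcos p_μ)ⁿ⁺¹∕(n+1)`. [cite: King1986, (4.4) p.670] -/
theorem hasSum_log_sub_kingLogSym (hc : 0 ≤ c) (hm : 0 < m2) (p : Fin (d + 1) → ℝ) :
    HasSum (fun n : ℕ => (hopRatio c m2 d * ∑ μ, Real.cos (p μ)) ^ (n + 1) / (n + 1)) (Real.log (m2 + 2 * c * (d + 1)) - kingLogSym c m2 p) := by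
  have hA : 0 < m2 + 2 * c * (d + 1) := by positivity
  have hS : |∑ μ, Real.cos (p μ)| ≤ d + 1 := by
    calc |∑ μ, Real.cos (p μ)| ≤ ∑ μ, |Real.cos (p μ)| := Finset.abs_sum_le_sum_abs _ _
      _ ≤ ∑ _μ : Fin (d + 1), (1 : ℝ) := Finset.sum_le_sum fun μ _ => Real.abs_cos_le_one _
      _ = d + 1 := by simp
  have hy : |hopRatio c m2 d * ∑ μ, Real.cos (p μ)| < 1 := by
    rw [abs_mul, abs_of_nonneg (hopRatio_nonneg hc hm d)]
    calc hopRatio c m2 d * |∑ μ, Real.cos (p μ)| ≤ hopRatio c m2 d * (d + 1) := mul_le_mul_of_nonneg_left hS (hopRatio_nonneg hc hm d)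
      _ < 1 := hopRatio_mul_lt_one hc hm d
  have hprod : m2 + c * ∑ μ, (2 - 2 * Real.cos (p μ)) = (m2 + 2 * c * (d + 1)) * (1 - hopRatio c m2 d * ∑ μ, Real.cos (p μ)) := by
    rw [hopRatio, Finset.sum_sub_distrib, Finset.sum_const, Finset.card_univ, Fintype.card_fin, ← Finset.mul_sum, nsmul_eq_mul]
    field_simp
    push_cast
    ring
  have h1y : 0 < 1 - hopRatio c m2 d * ∑ μ, Real.cos (p μ) := by linarith [(abs_lt.mp hy).2]
  have hlog : Real.log (m2 + 2 * c * (d + 1)) - kingLogSym c m2 p = -Real.log (1 - hopRatio c m2 d * ∑ μ, Real.cos (p μ)) := by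
    unfold kingLogSym
    rw [hprod, Real.log_mul hA.ne' h1y.ne']
    ring
  rw [hlog]
  exact Real.hasSum_pow_div_log_of_abs_lt_one hy

/-- the same on the complex side, at the real points of the zone: `ln A − logSymC(p) = Σ_n (t·X(p))ⁿ⁺¹∕(n+1)`. [cite: King1986, (4.4) p.670] -/
theorem log_sub_logSymC_ofRealVec_eq_tsum (hc : 0 ≤ c) (hm : 0 < m2) (p : Fin (d + 1) → ℝ) :
    ((Real.log (m2 + 2 * c * (d + 1)) : ℝ) : ℂ) - logSymC c m2 (ofRealVec p)
      = ∑' n : ℕ, (((hopRatio c m2 d : ℝ) : ℂ) * hopSymC (ofRealVec p)) ^ (n + 1) / ((n : ℂ) + 1) := by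
  rw [logSymC_ofRealVec hc hm, ← Complex.ofReal_sub, ← (hasSum_log_sub_kingLogSym hc hm p).tsum_eq, Complex.ofReal_tsum]
  refine tsum_congr fun n => ?_
  rw [hopSymC_ofRealVec]
  push_cast
  rfl

/-- the kernel of the `n`-th Neumann term is `tⁿ⁺¹∕(n+1)·W_{n+1}`. [cite: Balaban1983RegularityDecay, (2.43) p.584] -/
theorem latticeKernel_hopTerm (t : ℝ) (n : ℕ) (z : Fin (d + 1) → ℤ) :
    latticeKernel (fun P : Fin (d + 1) → ℂ => (((t : ℝ) : ℂ) * hopSymC P) ^ (n + 1) / ((n : ℂ) + 1)) z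
      = (((t : ℝ) : ℂ) ^ (n + 1) / ((n : ℂ) + 1)) * hopPowKer (n + 1) z := by
  unfold hopPowKer
  rw [← latticeKernel_const_mul]
  congr 1
  funext P
  ring

/-- the `n`-th Neumann term is bounded by `(t(d+1))ⁿ⁺¹` on the zone (`t ≥ 0`). [folklore] -/
theorem norm_hopTerm_le {t : ℝ} (ht : 0 ≤ t) (n : ℕ) (p : Fin (d + 1) → ℝ) :
    ‖(((t : ℝ) : ℂ) * hopSymC (ofRealVec p)) ^ (n + 1) / ((n : ℂ) + 1)‖ ≤ (t * (d + 1)) ^ (n + 1) := by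
  rw [norm_div, norm_pow, norm_mul, Complex.norm_real, Real.norm_eq_abs, abs_of_nonneg ht,
    show ((n : ℂ) + 1) = ((n + 1 : ℕ) : ℂ) by push_cast; ring, Complex.norm_natCast]
  have h1 : (1 : ℝ) ≤ ((n + 1 : ℕ) : ℝ) := by exact_mod_cast Nat.succ_le_succ (Nat.zero_le n)
  calc (t * ‖hopSymC (ofRealVec p)‖) ^ (n + 1) / ((n + 1 : ℕ) : ℝ) ≤ (t * ‖hopSymC (ofRealVec p)‖) ^ (n + 1) := div_le_self (by positivity) h1
    _ ≤ (t * (d + 1)) ^ (n + 1) := by gcongr; exact norm_hopSymC_ofRealVec_le p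

end Neumann

/-! ## §3 The lattice Fourier coefficients of the log-symbol are non-positive off the origin -/

section Sign

variable {c m2 : ℝ}

/-- ★★★ **THE NEUMANN EXPANSION OF THE LOG-KERNEL**: `ĥ(z) = ln(m²+2c(d+1))·δ_{z,0} − Σ_{n≥0} tⁿ⁺¹∕(n+1)·W_{n+1}(z)` (term-by-term integration of the uniformly convergent Neumann
series over the zone). [cite: King1986, (4.4) p.670; Balaban1983RegularityDecay, (2.43) p.584] -/
theorem logKerC_eq_sub_tsum (hc : 0 ≤ c) (hm : 0 < m2) (z : Fin (d + 1) → ℤ) :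
    logKerC c m2 z = ((Real.log (m2 + 2 * c * (d + 1)) : ℝ) : ℂ) * (if z = 0 then 1 else 0)
      - ∑' n : ℕ, (((hopRatio c m2 d : ℝ) : ℂ) ^ (n + 1) / ((n : ℂ) + 1)) * hopPowKer (n + 1) z := by
  set A : ℝ := m2 + 2 * c * (d + 1) with hA
  set t : ℝ := hopRatio c m2 d with ht
  set F : ℕ → (Fin (d + 1) → ℂ) → ℂ := fun n P => (((t : ℝ) : ℂ) * hopSymC P) ^ (n + 1) / ((n : ℂ) + 1) with hF
  set R : (Fin (d + 1) → ℂ) → ℂ := fun P => ((Real.log A : ℝ) : ℂ) - logSymC c m2 P with hR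
  have ht0 : 0 ≤ t := hopRatio_nonneg hc hm d
  have hρ1 : t * (d + 1) < 1 := hopRatio_mul_lt_one hc hm d
  have hρ0 : 0 ≤ t * (d + 1) := by positivity
  have hFd : ∀ n, Differentiable ℂ (F n) := fun n => by
    have hX : Differentiable ℂ (fun P : Fin (d + 1) → ℂ => hopSymC P) := differentiable_hopSymC
    simp only [hF]
    fun_prop
  have hFi : ∀ n, IntegrableOn (integrand (F n) z) (BZ (d + 1)) := fun n => integrableOn_of_differentiableAt (fun p _ => (hFd n).differentiableAt) z
  have hLi : IntegrableOn (integrand (logSymC c m2) z) (BZ (d + 1)) := (stripRegular_logSymC hc hm).integrableOn (kappaFree_pos hc hm d).le z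
  have hCi : IntegrableOn (integrand (fun _ : Fin (d + 1) → ℂ => ((Real.log A : ℝ) : ℂ)) z) (BZ (d + 1)) :=
    integrableOn_of_differentiableAt (fun p _ => differentiableAt_const _) z
  have hRi : IntegrableOn (integrand R z) (BZ (d + 1)) := by
    refine (hCi.sub hLi).congr_fun (fun p _ => ?_) measurableSet_Icc
    simp only [integrand, hR, Pi.sub_apply]
    ring
  have hpt : Set.EqOn (integrand R z) (fun p => ∑' n, integrand (F n) z p) (BZ (d + 1)) := by
    intro p _
    simp only [integrand, hR, hF]
    rw [log_sub_logSymC_ofRealVec_eq_tsum hc hm p, ← tsum_mul_right]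
  have hvol : volume (BZ (d + 1)) < ⊤ := by unfold BZ; exact measure_Icc_lt_top
  have hbound : ∀ n, ∫ p in BZ (d + 1), ‖integrand (F n) z p‖ ≤ (volume.real (BZ (d + 1))) * ((t * (d + 1)) * (t * (d + 1)) ^ n) := by
    intro n
    have h := norm_setIntegral_le_of_norm_le_const hvol (f := fun p => ‖integrand (F n) z p‖) (C := (t * (d + 1)) ^ (n + 1)) fun p _ => by
      rw [norm_norm]
      simp only [integrand, hF]
      rw [norm_mul, norm_cexp_phase, mul_one]
      exact norm_hopTerm_le ht0 n p
    rw [Real.norm_eq_abs, mul_comm] at h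
    rw [← pow_succ']
    exact (le_abs_self _).trans h
  have hsum : Summable fun n => ∫ p in BZ (d + 1), ‖integrand (F n) z p‖ :=
    Summable.of_nonneg_of_le (fun n => integral_nonneg fun p => norm_nonneg _) hbound
      (((summable_geometric_of_lt_one hρ0 hρ1).mul_left (t * (d + 1))).mul_left (volume.real (BZ (d + 1))))
  have hRker : latticeKernel R z = ∑' n, latticeKernel (F n) z := by
    unfold latticeKernel fourierBox
    simp only [Complex.real_smul]
    have hI : ∫ p in BZ (d + 1), integrand R z p = ∫ p in BZ (d + 1), ∑' n, integrand (F n) z p := setIntegral_congr_fun measurableSet_Icc hpt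
    rw [hI, ← integral_tsum_of_summable_integral_norm hFi hsum, tsum_mul_left]
  have hsplit : logSymC c m2 = fun P => ((Real.log A : ℝ) : ℂ) - R P := by
    funext P
    simp only [hR]
    ring
  have hconst : latticeKernel (fun _ : Fin (d + 1) → ℂ => ((Real.log A : ℝ) : ℂ)) z = ((Real.log A : ℝ) : ℂ) * (if z = 0 then 1 else 0) := by
    rw [← latticeKernel_one z, ← latticeKernel_const_mul]
    simp only [mul_one]
  unfold logKerC
  rw [hsplit, latticeKernel_sub z hCi hRi, hRker, hconst]
  congr 1
  exact tsum_congr fun n => latticeKernel_hopTerm t n z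

/-- the Neumann coefficient sequence of `ĥ(z)` is summable. [folklore] -/
theorem summable_hopTerm_mul_hopPowKer (hc : 0 ≤ c) (hm : 0 < m2) (z : Fin (d + 1) → ℤ) :
    Summable fun n : ℕ => (((hopRatio c m2 d : ℝ) : ℂ) ^ (n + 1) / ((n : ℂ) + 1)) * hopPowKer (n + 1) z := by
  have ht0 : 0 ≤ hopRatio c m2 d := hopRatio_nonneg hc hm d
  have hρ1 : hopRatio c m2 d * (d + 1) < 1 := hopRatio_mul_lt_one hc hm d
  have hρ0 : 0 ≤ hopRatio c m2 d * (d + 1) := by positivity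
  refine Summable.of_norm_bounded ((summable_geometric_of_lt_one hρ0 hρ1).mul_left (hopRatio c m2 d * (d + 1))) fun n => ?_
  rw [norm_mul, norm_div, norm_pow, Complex.norm_real, Real.norm_eq_abs, abs_of_nonneg ht0,
    show ((n : ℂ) + 1) = ((n + 1 : ℕ) : ℂ) by push_cast; ring, Complex.norm_natCast, ← pow_succ', mul_pow]
  have h1 : (1 : ℝ) ≤ ((n + 1 : ℕ) : ℝ) := by exact_mod_cast Nat.succ_le_succ (Nat.zero_le n)
  calc hopRatio c m2 d ^ (n + 1) / ((n + 1 : ℕ) : ℝ) * ‖hopPowKer (n + 1) z‖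
      ≤ hopRatio c m2 d ^ (n + 1) * (d + 1 : ℝ) ^ (n + 1) :=
        mul_le_mul (div_le_self (by positivity) h1) (norm_hopPowKer_le (n + 1) z) (norm_nonneg _) (by positivity)

/-- ★★★ **THE LATTICE FOURIER COEFFICIENTS OF THE LOG-SYMBOL ARE NON-POSITIVE OFF THE ORIGIN**: `Re ĥ(z) ≤ 0` for `z ≠ 0` (`c ≥ 0`, `m² > 0`).
[cite: King1986, (4.4) p.670; Balaban1983RegularityDecay, (2.43) p.584] -/
theorem logKerC_re_nonpos (hc : 0 ≤ c) (hm : 0 < m2) {z : Fin (d + 1) → ℤ} (hz : z ≠ 0) : (logKerC c m2 z).re ≤ 0 := by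
  rw [logKerC_eq_sub_tsum hc hm z, if_neg hz, mul_zero, zero_sub, Complex.neg_re, neg_nonpos, Complex.re_tsum (summable_hopTerm_mul_hopPowKer hc hm z)]
  refine tsum_nonneg fun n => ?_
  rw [hopPowKer_eq_re (n + 1) z, show ((hopRatio c m2 d : ℝ) : ℂ) ^ (n + 1) / ((n : ℂ) + 1) = (((hopRatio c m2 d) ^ (n + 1) / (n + 1) : ℝ) : ℂ) by push_cast; ring,
    ← Complex.ofReal_mul, Complex.ofReal_re]
  exact mul_nonneg (div_nonneg (pow_nonneg (hopRatio_nonneg hc hm d) _) (by positivity)) (hopPowKer_re_nonneg _ _)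

end Sign

end Summit.QuantumFields.YangMills.BalabanUVNodes.N15KingModelRung.TorusSpectral

end
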